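import Summits.HodgeConjecture.HodgeConjecture.Theorems.R90S1KeysReducibleOfCases       -- ★ p861544 (this seat): `reducible_of_keysCases` (socket A2 «⇐» in full)
import Summits.HodgeConjecture.HodgeConjecture.Theorems.K2E3KeysThmTwoOfContracting      -- ★ the Weyl-flip pattern; brings ★ `cmPrincipalSeries_weylConj_reducible_of_reducible`, ★ `K2E3NonUnitaryCharacterDichotomy`, ★ UniqPar
import Summits.HodgeConjecture.HodgeConjecture.Theorems.K2E3IrregularReducibleCaseThree  -- ★ `irregularReducibleCaseThree` (Keys Thm (1) ⇒ at `wχ = χ`, hypothesis-free)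
import Summits.HodgeConjecture.HodgeConjecture.Theorems.F0P3cStCharTSPSIrredRegular      -- ★ Bruhat: `cmWeylTorusCharPair_eq_of_ne_bot_ne_top`
import HarnessLib

/-!
# R90-TF · S1 «Ch. 12.2 local, non-split `v`» — KEYS' TRICHOTOMY (socket A2) ⟸ ONE PRINT-EXACT INPUT: [Keys1984 §7 Thm (2)] in its «`Re s > 0`» (CONTRACTING) normal
# form at the place `v` with second coordinate `χ₂`  [Rogawski1990 §12.2 p. 173 ll. 8–12]

Cell `hodgecm-mathlib`, crux H413 (`stmt-HodgeConjecture-24833`), route of record `HCCMUnconditional`; programme R90-TF (brief `director/R90-BRIEF.v2.md`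
1f40d54518340a35), section S1 = Ch. 12.2 local (base `R90-C10`), seat R90-C10-p04 (g0), socket S1#3 = A2 `R90.S1.stub_R90_122_keys_trichotomy` of
`Cruxes/H413/Lines/R90_S1_NonsplitLocalPacketsA.lean`, ROAD «⇐ + FRAME» — brick (F-c), the GENERAL frame (companion of ★ (F-b) `keys_trichotomy_of_unramified`, which is
the unconditional special case `χ` trivial on `T ∩ K_v`).  Helper file, lane `--supports stmt-HodgeConjecture-24833 --as helper`; ONE theorem, no definition, no instance,
no notation, no `sorry`; ★-only imports (never a `Cruxes/…/Lines` module; §0 vocabulary pasted unfolded).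
HONEST LABEL: HC_CM is proved only modulo the 7 printed citations (2 remaining named inputs: hLiu418 = stmt-HodgeConjecture-24832, h413 = stmt-HodgeConjecture-24833)
until rung 0 closes; count-neutral: a CONDITIONAL assembly — it proves A2 at `(χ₁, χ₂)` from the hypothesis `hKc` (below), it does NOT discharge `hKc`.

WHAT `hKc` IS (print-exact, MINIMAL, LOCAL).  [Keys1984 §7 p. 126]: «We may assume `Re λ > 0`. … THEOREM (2) Suppose `λ ∈ (E^×)^` and `Re s > 0`. The representation
`Ind_P^G λ_s` is reducible only if (a) `λ = 1`, `s = 1` … (c) `λ|_{F^×} = ω`, `s = ½`» = [Rogawski1990 §12.2 (1)(2)] read at the CONTRACTING member of each `W`-orbit: at the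
fixed place `v` and second coordinate `χ₂`, for every continuous NON-UNITARY CONTRACTING `χ₁'` (`‖x‖ < 1 ⇒ |χ₁'(x)| < 1`, ★ `unitModulusChar`), if `i_G(χ₁', χ₂)` has a `G`-stable
`⊥ ≠ N ≠ ⊤` then `χ₁' = ‖·‖` or `χ₁' = η‖·‖^{1/2}` with `η∣F* = ω_{E/F}`, `η` continuous.  In the tree `hKc` is ★ for `(χ₁', χ₂)` trivial on `T ∩ K_v`
(★ `K2E3KeysThmTwoContractingRamified.keysThmTwoContracting_of_unramified_nonsplit`); the RAMIFIED pairs are the open residue of S1#3 (seat p05's road).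

THE PROOF.  «⇐»: ★ `reducible_of_keysCases` (all `χ`).  «⇒»: unitary `χ₁` ⇒ `wχ = χ` (★ Bruhat `cmWeylTorusCharPair_eq_of_ne_bot_ne_top`) ⇒ case (3) (★ `irregularReducibleCaseThree`);
non-unitary `χ₁`: contracting ⇒ `hKc` at `χ₁`; expanding ⇒ `hKc` at `wχ₁ = χ̄₁⁻¹` (★ `conjInvChar_contracting_of_expanding`, ★ `exists_norm_conjInvChar_ne_one`, `i_G(wχ)` reducible by
★ `cmPrincipalSeries_weylConj_reducible_of_reducible` + regularity ★ `cmTorusCharPair_ne_weyl_of_exists_norm_ne_one`) and back by `w² = 1` (★ `conjInvChar_conjInvChar`,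
★ `conjInvChar_normSqInv`, ★ `conjInvChar_quadChar_mul_half`) — verbatim the flip of ★ `K2E3KeysThmTwoOfContracting.keysThmTwo_of_contracting`, POINTWISE in `(L, v, χ₂)`.

## References
* [Rogawski1990] J. D. Rogawski, *Automorphic Representations of Unitary Groups in Three Variables*, Ann. of Math. Stud. 123 (1990): §12.2 (1)–(3) p. 173.
* [Keys1984] D. Keys, *Principal series representations of special unitary groups over local fields*, Compositio Math. 51 (1984) 115–130: §7 Theorem (1)–(2) p. 126.
* [Casselman1995] W. Casselman, *Introduction to the theory of admissible representations of p-adic reductive groups* (draft 1995): Thm. 6.6.1 (Bruhat).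
* [BernsteinZelevinsky1977] I. N. Bernstein, A. V. Zelevinsky, *Induced representations of reductive p-adic groups I*, Ann. Sci. ÉNS 10 (1977): Thm. 2.9.
-/

set_option autoImplicit false
-- the mandated namespace repeats the single-problem summit's segment (`HodgeConjecture.HodgeConjecture`)
set_option linter.dupNamespace false

noncomputable section

open NumberField IsDedekindDomain
open scoped Matrix

open Literature.NumberTheory Literature.NumberTheory.Automorphic Literature.NumberTheory.Automorphic.UnitaryGroup
open Literature.NumberTheory.Rogawski1990
open Summit.HodgeConjecture.HodgeConjecture.Cruxes.H413

namespace Summit.HodgeConjecture.HodgeConjecture.R90.S1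

variable (L : Type) [Field L] [NumberField L] [IsCMField L]

set_option synthInstance.maxHeartbeats 400000 in
set_option maxHeartbeats 3200000 in
-- statement-heavy: the `SmoothInd` carrier of `cmPrincipalSeries` in the hypothesis and the goal (same budget class as ★ `keysThmTwo_of_contracting`)
/-- **KEYS' TRICHOTOMY (socket A2 `R90.S1.stub_R90_122_keys_trichotomy`, TOKEN FOR TOKEN, §0 `def`s unfolded) FROM [Keys1984 §7 Thm (2)] IN «`Re s > 0`» FORM AT `(v, χ₂)`.**
`hKc`: at the non-split place `v`, for every continuous non-unitary CONTRACTING `χ₁'`, a reducible `i_G(χ₁', χ₂)` has `χ₁' = ‖·‖` (`= halfModulusChar²`) or `χ₁' = η‖·‖^{1/2}` with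
`η∣_{F_v^×} = ω_{E_w/F_v}` (★ `IsQuadraticCharExtension`), `η` continuous.  Conclusion: for every continuous `χ₁`, `i_G(χ₁, χ₂)` has a `G`-stable `⊥ ≠ N ≠ ⊤` iff `χ₁` is in Keys'
case (1) `‖·‖^{±1}`, (2) `η‖·‖^{±1/2}`, or (3) `χ₁ ≠ 1`, `χ₁∣_{F_v^×} = 1`.  «⇐» ★ `reducible_of_keysCases`; «⇒» unitary: ★ Bruhat + ★ `irregularReducibleCaseThree`; non-unitary:
`hKc` at `χ₁` (contracting) or at `wχ₁` (expanding; ★ flip lemmas, ★ `cmPrincipalSeries_weylConj_reducible_of_reducible`, `w² = 1`).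
[cite: Rogawski1990, §12.2 (1)–(3) p. 173] [cite: Keys1984, §7 Theorem (1)–(2) p. 126] [cite: Casselman1995, Thm. 6.6.1] [cite: BernsteinZelevinsky1977, Thm. 2.9] -/
theorem keys_trichotomy_of_keysThmTwoContracting (v : HeightOneSpectrum (𝓞 ↥(maximalRealSubfield L)))
    (hns : ∀ w : PlacesOver L v, IsCMField.complexConj L • w.1 = w.1)
    (χ₂ : ↥(normOneUnits (conjLocal L (IsCMField.complexConj L) v)) →* ℂˣ) (h2c : Continuous fun x => ((χ₂ x : ℂˣ) : ℂ))
    (hKc : ∀ χ₁' : (LocalRing L v)ˣ →* ℂˣ, Continuous (fun x => ((χ₁' x : ℂˣ) : ℂ)) → (∃ x, ‖((χ₁' x : ℂˣ) : ℂ)‖ ≠ 1) →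
      (∀ x : (LocalRing L v)ˣ, unitModulusChar (LocalRing L v) x < 1 → ‖((χ₁' x : ℂˣ) : ℂ)‖ < 1) →
      (∃ N : Subrepresentation (cmPrincipalSeries L 3 v (cmTorusCharPair L v χ₁' χ₂)), N ≠ ⊥ ∧ N ≠ ⊤) →
      χ₁' = halfModulusChar (LocalRing L v) * halfModulusChar (LocalRing L v) ∨
        (∃ η : (LocalRing L v)ˣ →* ℂˣ, IsQuadraticCharExtension (conjLocal L (IsCMField.complexConj L) v) η ∧
          Continuous (fun x => ((η x : ℂˣ) : ℂ)) ∧ χ₁' = η * halfModulusChar (LocalRing L v)))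
    (χ₁ : (LocalRing L v)ˣ →* ℂˣ) (h1c : Continuous fun x => ((χ₁ x : ℂˣ) : ℂ)) :
    (∃ N : Subrepresentation (cmPrincipalSeries L 3 v (cmTorusCharPair L v χ₁ χ₂)), N ≠ ⊥ ∧ N ≠ ⊤) ↔
      ((χ₁ = halfModulusChar (LocalRing L v) * halfModulusChar (LocalRing L v) ∨
          χ₁ = (halfModulusChar (LocalRing L v) * halfModulusChar (LocalRing L v))⁻¹) ∨
        (∃ η : (LocalRing L v)ˣ →* ℂˣ, IsQuadraticCharExtension (conjLocal L (IsCMField.complexConj L) v) η ∧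
          Continuous (fun x => ((η x : ℂˣ) : ℂ)) ∧
          (χ₁ = η * halfModulusChar (LocalRing L v) ∨ χ₁ = η * (halfModulusChar (LocalRing L v))⁻¹)) ∨
        (χ₁ ≠ 1 ∧ ∀ x : (LocalRing L v)ˣ, conjLocal L (IsCMField.complexConj L) v (x : LocalRing L v) = x → χ₁ x = 1)) := by
  refine ⟨fun hred => ?_, reducible_of_keysCases L v hns χ₁ χ₂ h1c h2c⟩
  by_cases hu : ∀ x, ‖((χ₁ x : ℂˣ) : ℂ)‖ = 1
  · -- unitary `χ₁`: ★ Bruhat ⇒ `wχ = χ`; ★ `irregularReducibleCaseThree` ⇒ case (3)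
    have hw : cmWeylTorusCharPair L v χ₁ χ₂ = cmTorusCharPair L v χ₁ χ₂ :=
      F0P3cStCharTSPSIrredRegular.cmWeylTorusCharPair_eq_of_ne_bot_ne_top L v hns χ₁ χ₂ h1c h2c hu hred
    have hfix : cmTorusCharPair L v χ₁ χ₂ = cmTorusCharPair L v (conjInvChar (conjLocal L (IsCMField.complexConj L) v) χ₁) χ₂ :=
      ((cmWeylTorusCharPair_eq L v χ₁ χ₂).symm.trans hw).symm
    exact Or.inr (Or.inr (K2E3IrregularReducibleCaseThree.irregularReducibleCaseThree L v hns χ₁ χ₂ h1c h2c hfix hred))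
  · -- non-unitary `χ₁`: `hKc` at the contracting member of `{χ₁, wχ₁}`
    push Not at hu
    rcases K2E3NonUnitaryCharacterDichotomy.contracting_or_expanding_of_exists_norm_ne_one L v hns χ₁ h1c hu with hc | he
    · rcases hKc χ₁ h1c hu hc hred with h | ⟨η, hq, hηc, h⟩
      · exact Or.inl (Or.inl h)
      · exact Or.inr (Or.inl ⟨η, hq, hηc, Or.inl h⟩)
    · -- expanding: flip by `w`, apply `hKc` at `wχ₁`, flip back (`w² = 1`)
      have h1c' : Continuous fun x => ((conjInvChar (conjLocal L (IsCMField.complexConj L) v) χ₁ x : ℂˣ) : ℂ) :=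
        F0P2pTorusPairsAndVacuity.continuous_coe_conjInvChar _ (continuous_conjLocal L (IsCMField.complexConj L) v) χ₁ h1c
      have hnu' := K2E3NonUnitaryCharacterDichotomy.exists_norm_conjInvChar_ne_one L v χ₁ hu
      have hc' : ∀ x : (LocalRing L v)ˣ, unitModulusChar (LocalRing L v) x < 1 →
          ‖((conjInvChar (conjLocal L (IsCMField.complexConj L) v) χ₁ x : ℂˣ) : ℂ)‖ < 1 :=
        fun x hx => K2E3NonUnitaryCharacterDichotomy.conjInvChar_contracting_of_expanding L v χ₁ he x hx
      have hreg := K2E3NonUnitaryCharacterDichotomy.cmTorusCharPair_ne_weyl_of_exists_norm_ne_one L v hns χ₁ χ₂ h1c hu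
      have hred' := K2E3PrincipalSeriesWeylReducible.cmPrincipalSeries_weylConj_reducible_of_reducible L v hns χ₁ χ₂ h1c h2c hreg hred
      have hww : conjInvChar (conjLocal L (IsCMField.complexConj L) v) (conjInvChar (conjLocal L (IsCMField.complexConj L) v) χ₁) = χ₁ :=
        F0P2pTorusPairsAndVacuity.conjInvChar_conjInvChar _ (conjLocal_conjLocal_cm L v) χ₁
      have hsq : conjInvChar (conjLocal L (IsCMField.complexConj L) v) (halfModulusChar (LocalRing L v) * halfModulusChar (LocalRing L v)) =
          (halfModulusChar (LocalRing L v) * halfModulusChar (LocalRing L v))⁻¹ := by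
        have e := congrArg (conjInvChar (conjLocal L (IsCMField.complexConj L) v)) (F0P3cStCharTSUniqPar.conjInvChar_normSqInv L v)
        rw [F0P2pTorusPairsAndVacuity.conjInvChar_conjInvChar _ (conjLocal_conjLocal_cm L v)] at e
        exact e.symm
      rcases hKc (conjInvChar (conjLocal L (IsCMField.complexConj L) v) χ₁) h1c' hnu' hc' hred' with h | ⟨η, hq, hηc, h⟩
      · refine Or.inl (Or.inr ?_)
        rw [← hww, h, hsq]
      · refine Or.inr (Or.inl ⟨η, hq, hηc, Or.inr ?_⟩)
        rw [← hww, h, F0P3cStCharTSUniqPar.conjInvChar_quadChar_mul_half L v η hq]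

end Summit.HodgeConjecture.HodgeConjecture.R90.S1

end
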